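import Summits.QuantumFields.BalabanUV.T4Continuum.Support.NE3ProductPath
import Summits.QuantumFields.BalabanUV.T4Continuum.Support.NE3EnergyWeightedShapes
import Summits.QuantumFields.BalabanUV.T4Continuum.Support.NE3EnergyHessContTwoTerm
import Summits.QuantumFields.BalabanUV.T4Continuum.Support.NE3LocalCrudeWPair
import Summits.QuantumFields.BalabanUV.T4Continuum.Support.NE3HessShapes
import Summits.QuantumFields.BalabanUV.T4Continuum.Support.AveragingDeficitNearIdentity
import HarnessLib

/-!
# T⁴ programme, node NE3 — route Π, bounds for the product path (1∕2): the algebra of the η-weighted energy norm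
# (`energyNormW` is a seminorm; the crude curl bound; relative pointwise bounds) and the ℓ¹ bond multiplicity on the torus

NE3 (node U1b), row NE3 OWNER `b2b-balaban-t4-ne3-p1` (gen 24); route Π, design note `D-ne3p1-g24-1.md` §4; companion of `NE3ProductPath`
(exact formulas) and input of `NE3ProductPathChart` (the endpoint chart from a decomposed representative).

CONTENT ([folklore]; 0 def, 0 sorry):
§1 linearity of the dressed curl in the direction (`curl_add_dir`, `curl_smul_dir`, `curl_sub_dir`), `curlSq`∕`dirSq` homogeneity,
   **`energyNormW_smul`**, **`energyNormW_add_le`** (Minkowski), `energyNormW_neg`, `energyNormW_sub_le`;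
§2 **`curlSq_le_dirSq`** (`curlSq ≤ 16d·dirSq` on the torus for periodic
   directions, from `NE3HessBounds.norm_curlAt_sq_le` + `NE3HessShapes.sum_plaqsOf_bondSq_le`), **`energyNormW_le_of_pointwise`**
   (`‖Z b‖ ≤ c‖Y b‖` pointwise ⟹ `N_w Z ≤ √(16d+1)·c·L^k·N_w Y` — a SUP-type relative bound costs exactly one `L^k`);
§3 **`sum_plaqsOf_bondL1_le`** (`Σ_{p} bondL1 Z p ≤ 4d·dirL1 Z` on the torus — the ℓ¹ twin of `sum_plaqsOf_bondSq_le`),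
   `sum_norm_curl_le_dirL1`.  (The pointwise sizes along the product path are in the companion `NE3ProductPathSizes`.)

HONEST FRAMING.  Elementary inequalities; nothing about Bałaban's minimisers; NE3 NOT proved; spine PROVED 0∕9; finite T⁴ rung (B)+1 —
NOT infinite volume, NOT mass gap, NOT `BetaPertH`, NOT Clay.  PLACEMENT: `Summits/QuantumFields/BalabanUV/`.  HONEST DEPENDENCY:
continuum YM on T⁴ ⇐ BetaPertH ∧ nine spine estimates (0/9 proved); BetaPertH ⇐ (D1) ∧ (D4) ∧ CAP+tail; G-an2-4 gates asym, D1 and NE2/3/4.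
-/

set_option autoImplicit false

open scoped BigOperators Matrix.Norms.L2Operator
open NormedSpace Finset

namespace Summit.QuantumFields.BalabanUV.T4Continuum.NE3ProductPathBounds

open Set
open Literature.MathematicalPhysics.QuantumFieldTheory.Balaban1983to89
open B7Prop1Explicit B7Prop2Explicit MatrixLog
open T4AveragingDeficitWall (IsSkewDir IsUnitaryCfg vary Ad curl curlAt curlSq dirSq dirL1)
open T4AveragingDeficitWallBoundary (periodBox sum_periodBox_shift)
open AveragingDeficitPeriodicCounting (IsPeriodicDir)
open AveragingDeficitTransport (norm_Ad_of_unitary)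
open AveragingDeficitNearIdentity (Ad_add Ad_smul Ad_one)
open AveragingDeficitBlockDensity (norm_exp_sub_one_le_two_mul)
open NE3HessBounds (bondSq bondSqAt norm_curlAt_le norm_curlAt_sq_le)
open NE3HessContinuity (bondL1 bondL1At)
open NE3HessShapes (plaqsOf sum_plaqsOf curlSq_eq_sum_plaqsOf sum_plaqsOf_bondSq_le)
open NE3CurlStability (norm_Ad_sub_Ad_le)
open NE3EnergyWeightedShapes (energyNormW energyNormW_nonneg)
open NE3EnergyHessContTwoTerm (curlSq_nonneg dirSq_nonneg)
open NE3LocalCrudeWPair (dirSq_le_pow_sq_mul_energyNormW_sq)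
open NE3ProductPath

noncomputable section

variable {d : ℕ} {n : Type*} [Fintype n] [DecidableEq n]

/-! ## §1 The weighted energy norm is a seminorm -/

/-- `0 ≤ curlSq + w·dirSq`. [folklore] -/
theorem energySq_nonneg (L k : ℕ) (V : Site d → Fin d → (Matrix n n ℂ)ˣ) (Z : Site d → Fin d → Matrix n n ℂ) (F : Finset (Site d)) :
    0 ≤ curlSq V Z F + ((L : ℝ) ^ k)⁻¹ ^ 2 * dirSq Z F := by
  have := curlSq_nonneg V Z F; have := dirSq_nonneg Z F; positivity

/-- The dressed curl is additive in the direction. [folklore] -/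
theorem curl_add_dir (V : Site d → Fin d → (Matrix n n ℂ)ˣ) (Y Z : Site d → Fin d → Matrix n n ℂ) (p : T4AveragingDeficitWall.Plaq d) :
    curl V (Y + Z) p = curl V Y p + curl V Z p := by
  simp only [curl, curlAt, Pi.add_apply, Ad_add]
  abel

/-- The dressed curl is `ℂ`-homogeneous in the direction. [folklore] -/
theorem curl_smul_dir (V : Site d → Fin d → (Matrix n n ℂ)ˣ) (c : ℂ) (Z : Site d → Fin d → Matrix n n ℂ)
    (p : T4AveragingDeficitWall.Plaq d) : curl V (c • Z) p = c • curl V Z p := by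
  simp only [curl, curlAt, Pi.smul_apply, Ad_smul, smul_add, smul_sub]

/-- The dressed curl of a difference. [folklore] -/
theorem curl_sub_dir (V : Site d → Fin d → (Matrix n n ℂ)ˣ) (Y Z : Site d → Fin d → Matrix n n ℂ) (p : T4AveragingDeficitWall.Plaq d) :
    curl V (Y - Z) p = curl V Y p - curl V Z p := by
  rw [sub_eq_add_neg, curl_add_dir, show -Z = (-1 : ℂ) • Z by simp, curl_smul_dir]
  simp [sub_eq_add_neg]

/-- `curlSq V (c•Z) F = ‖c‖²·curlSq V Z F`. [folklore] -/
theorem curlSq_smul (V : Site d → Fin d → (Matrix n n ℂ)ˣ) (c : ℂ) (Z : Site d → Fin d → Matrix n n ℂ) (F : Finset (Site d)) :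
    curlSq V (c • Z) F = ‖c‖ ^ 2 * curlSq V Z F := by
  unfold curlSq
  simp_rw [Finset.mul_sum]
  refine Finset.sum_congr rfl fun z _ => Finset.sum_congr rfl fun π _ => ?_
  rw [curl_smul_dir, norm_smul, mul_pow]

/-- `dirSq (c•Z) F = ‖c‖²·dirSq Z F`. [folklore] -/
theorem dirSq_smul (c : ℂ) (Z : Site d → Fin d → Matrix n n ℂ) (F : Finset (Site d)) :
    dirSq (c • Z) F = ‖c‖ ^ 2 * dirSq Z F := by
  unfold dirSq
  simp_rw [Finset.mul_sum]
  refine Finset.sum_congr rfl fun z _ => Finset.sum_congr rfl fun κ _ => ?_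
  rw [Pi.smul_apply, Pi.smul_apply, norm_smul, mul_pow]

/-- **HOMOGENEITY**: `N_w(c•Z) = ‖c‖·N_w(Z)`. [folklore] -/
theorem energyNormW_smul (L k : ℕ) (W : Site d → Fin d → (Matrix n n ℂ)ˣ) (c : ℂ) (Z : Site d → Fin d → Matrix n n ℂ)
    (F : Finset (Site d)) : energyNormW L k W (c • Z) F = ‖c‖ * energyNormW L k W Z F := by
  unfold NE3EnergyWeightedShapes.energyNormW
  rw [curlSq_smul, dirSq_smul, show ‖c‖ ^ 2 * curlSq W Z F + ((L : ℝ) ^ k)⁻¹ ^ 2 * (‖c‖ ^ 2 * dirSq Z F)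
    = ‖c‖ ^ 2 * (curlSq W Z F + ((L : ℝ) ^ k)⁻¹ ^ 2 * dirSq Z F) by ring, Real.sqrt_mul' _ (energySq_nonneg L k W Z F),
    Real.sqrt_sq (norm_nonneg _)]

/-- `N_w(−Z) = N_w(Z)`. [folklore] -/
theorem energyNormW_neg (L k : ℕ) (W : Site d → Fin d → (Matrix n n ℂ)ˣ) (Z : Site d → Fin d → Matrix n n ℂ) (F : Finset (Site d)) :
    energyNormW L k W (-Z) F = energyNormW L k W Z F := by
  rw [show -Z = (-1 : ℂ) • Z by simp, energyNormW_smul, norm_neg, norm_one, one_mul]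

/-- The two-family Cauchy–Schwarz step behind Minkowski: `√A√B + w·√C√D ≤ √(A + wC)·√(B + wD)` for non-negative reals. [folklore] -/
theorem sqrt_mul_sqrt_add_le {A B C D w : ℝ} (hA : 0 ≤ A) (hB : 0 ≤ B) (hC : 0 ≤ C) (hD : 0 ≤ D) (hw : 0 ≤ w) :
    Real.sqrt A * Real.sqrt B + w * (Real.sqrt C * Real.sqrt D) ≤ Real.sqrt (A + w * C) * Real.sqrt (B + w * D) := by
  have ha := Real.sqrt_nonneg A; have hb := Real.sqrt_nonneg B; have hc := Real.sqrt_nonneg C; have hd' := Real.sqrt_nonneg D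
  have hA' := Real.mul_self_sqrt hA; have hB' := Real.mul_self_sqrt hB
  have hC' := Real.mul_self_sqrt hC; have hD' := Real.mul_self_sqrt hD
  have hAB : Real.sqrt A * Real.sqrt B * (Real.sqrt A * Real.sqrt B) = A * B := by
    calc _ = (Real.sqrt A * Real.sqrt A) * (Real.sqrt B * Real.sqrt B) := by ring
      _ = A * B := by rw [hA', hB']
  have hCD : Real.sqrt C * Real.sqrt D * (Real.sqrt C * Real.sqrt D) = C * D := by
    calc _ = (Real.sqrt C * Real.sqrt C) * (Real.sqrt D * Real.sqrt D) := by ring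
      _ = C * D := by rw [hC', hD']
  have hAD : Real.sqrt A * Real.sqrt D * (Real.sqrt A * Real.sqrt D) = A * D := by
    calc _ = (Real.sqrt A * Real.sqrt A) * (Real.sqrt D * Real.sqrt D) := by ring
      _ = A * D := by rw [hA', hD']
  have hBC : Real.sqrt B * Real.sqrt C * (Real.sqrt B * Real.sqrt C) = B * C := by
    calc _ = (Real.sqrt B * Real.sqrt B) * (Real.sqrt C * Real.sqrt C) := by ring
      _ = B * C := by rw [hB', hC']
  have hcross : 2 * (Real.sqrt A * Real.sqrt B * (Real.sqrt C * Real.sqrt D)) ≤ A * D + B * C := by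
    have h := mul_self_nonneg (Real.sqrt A * Real.sqrt D - Real.sqrt B * Real.sqrt C)
    nlinarith [hAD, hBC]
  have key : (Real.sqrt A * Real.sqrt B + w * (Real.sqrt C * Real.sqrt D)) ^ 2 ≤ (A + w * C) * (B + w * D) := by
    have e : (Real.sqrt A * Real.sqrt B + w * (Real.sqrt C * Real.sqrt D)) ^ 2
        = Real.sqrt A * Real.sqrt B * (Real.sqrt A * Real.sqrt B)
          + w * (2 * (Real.sqrt A * Real.sqrt B * (Real.sqrt C * Real.sqrt D)))
          + w ^ 2 * (Real.sqrt C * Real.sqrt D * (Real.sqrt C * Real.sqrt D)) := by ring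
    rw [e, hAB, hCD]
    nlinarith [mul_le_mul_of_nonneg_left hcross hw]
  have h0 : 0 ≤ Real.sqrt A * Real.sqrt B + w * (Real.sqrt C * Real.sqrt D) := by positivity
  calc Real.sqrt A * Real.sqrt B + w * (Real.sqrt C * Real.sqrt D)
      = Real.sqrt ((Real.sqrt A * Real.sqrt B + w * (Real.sqrt C * Real.sqrt D)) ^ 2) := (Real.sqrt_sq h0).symm
    _ ≤ Real.sqrt ((A + w * C) * (B + w * D)) := Real.sqrt_le_sqrt key
    _ = Real.sqrt (A + w * C) * Real.sqrt (B + w * D) := Real.sqrt_mul (by positivity) _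

/-- Minkowski for a finite family of matrices: `√Σ‖a+b‖² ≤ √Σ‖a‖² + √Σ‖b‖²` in squared form
`Σ‖a i + b i‖² ≤ Σ‖a i‖² + Σ‖b i‖² + 2√(Σ‖a i‖²)√(Σ‖b i‖²)`. [folklore] -/
theorem sum_norm_add_sq_le {ι : Type*} (s : Finset ι) (a b : ι → Matrix n n ℂ) :
    ∑ i ∈ s, ‖a i + b i‖ ^ 2 ≤ ∑ i ∈ s, ‖a i‖ ^ 2 + ∑ i ∈ s, ‖b i‖ ^ 2
      + 2 * (Real.sqrt (∑ i ∈ s, ‖a i‖ ^ 2) * Real.sqrt (∑ i ∈ s, ‖b i‖ ^ 2)) := by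
  have h1 : ∑ i ∈ s, ‖a i + b i‖ ^ 2 ≤ ∑ i ∈ s, (‖a i‖ ^ 2 + ‖b i‖ ^ 2 + 2 * (‖a i‖ * ‖b i‖)) :=
    Finset.sum_le_sum fun i _ => by
      have := norm_add_le (a i) (b i)
      have h0 := norm_nonneg (a i + b i)
      nlinarith [norm_nonneg (a i), norm_nonneg (b i)]
  have hCS : ∑ i ∈ s, ‖a i‖ * ‖b i‖ ≤ Real.sqrt (∑ i ∈ s, ‖a i‖ ^ 2) * Real.sqrt (∑ i ∈ s, ‖b i‖ ^ 2) := by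
    rw [← Real.sqrt_mul (Finset.sum_nonneg fun i _ => sq_nonneg _)]
    refine Real.le_sqrt_of_sq_le ?_
    exact Finset.sum_mul_sq_le_sq_mul_sq s (fun i => ‖a i‖) (fun i => ‖b i‖)
  simp only [Finset.sum_add_distrib, ← Finset.mul_sum] at h1
  linarith

/-- **MINKOWSKI FOR THE WEIGHTED ENERGY NORM**: `N_w(Y + Z) ≤ N_w(Y) + N_w(Z)`. [folklore] -/
theorem energyNormW_add_le (L k : ℕ) (W : Site d → Fin d → (Matrix n n ℂ)ˣ) (Y Z : Site d → Fin d → Matrix n n ℂ)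
    (F : Finset (Site d)) : energyNormW L k W (Y + Z) F ≤ energyNormW L k W Y F + energyNormW L k W Z F := by
  unfold NE3EnergyWeightedShapes.energyNormW
  set w : ℝ := ((L : ℝ) ^ k)⁻¹ ^ 2 with hw
  have hw0 : 0 ≤ w := by rw [hw]; positivity
  -- the curl family and the bond family
  have hc : curlSq W (Y + Z) F ≤ curlSq W Y F + curlSq W Z F
      + 2 * (Real.sqrt (curlSq W Y F) * Real.sqrt (curlSq W Z F)) := by
    have h := sum_norm_add_sq_le (plaqsOf F) (fun p => curl W Y p) (fun p => curl W Z p)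
    simp only [← curl_add_dir] at h
    simpa only [curlSq_eq_sum_plaqsOf] using h
  have e : ∀ G : Site d → Fin d → Matrix n n ℂ,
      dirSq G F = ∑ b ∈ F ×ˢ (Finset.univ : Finset (Fin d)), ‖G b.1 b.2‖ ^ 2 := by
    intro G; unfold dirSq; rw [Finset.sum_product]
  have hd : dirSq (Y + Z) F ≤ dirSq Y F + dirSq Z F + 2 * (Real.sqrt (dirSq Y F) * Real.sqrt (dirSq Z F)) := by
    have h := sum_norm_add_sq_le (F ×ˢ (Finset.univ : Finset (Fin d))) (fun b : Site d × Fin d => Y b.1 b.2)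
      (fun b : Site d × Fin d => Z b.1 b.2)
    rw [e Y, e Z, e (Y + Z)]
    simpa only [Pi.add_apply] using h
  have hA := curlSq_nonneg W Y F
  have hB := curlSq_nonneg W Z F
  have hC := dirSq_nonneg Y F
  have hD := dirSq_nonneg Z F
  have hcs := sqrt_mul_sqrt_add_le hA hB hC hD hw0
  have hwd := mul_le_mul_of_nonneg_left hd hw0
  have hsum : curlSq W (Y + Z) F + w * dirSq (Y + Z) F
      ≤ (Real.sqrt (curlSq W Y F + w * dirSq Y F) + Real.sqrt (curlSq W Z F + w * dirSq Z F)) ^ 2 := by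
    rw [add_sq, Real.sq_sqrt (add_nonneg hA (mul_nonneg hw0 hC)), Real.sq_sqrt (add_nonneg hB (mul_nonneg hw0 hD))]
    have e : w * (dirSq Y F + dirSq Z F + 2 * (Real.sqrt (dirSq Y F) * Real.sqrt (dirSq Z F)))
        = w * dirSq Y F + w * dirSq Z F + 2 * (w * (Real.sqrt (dirSq Y F) * Real.sqrt (dirSq Z F))) := by ring
    rw [e] at hwd
    linarith [hc, hwd, hcs]
  calc Real.sqrt (curlSq W (Y + Z) F + w * dirSq (Y + Z) F)
      ≤ Real.sqrt ((Real.sqrt (curlSq W Y F + w * dirSq Y F) + Real.sqrt (curlSq W Z F + w * dirSq Z F)) ^ 2) :=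
        Real.sqrt_le_sqrt hsum
    _ = _ := Real.sqrt_sq (add_nonneg (Real.sqrt_nonneg _) (Real.sqrt_nonneg _))

/-- `N_w(Y − Z) ≤ N_w(Y) + N_w(Z)`. [folklore] -/
theorem energyNormW_sub_le (L k : ℕ) (W : Site d → Fin d → (Matrix n n ℂ)ˣ) (Y Z : Site d → Fin d → Matrix n n ℂ)
    (F : Finset (Site d)) : energyNormW L k W (Y - Z) F ≤ energyNormW L k W Y F + energyNormW L k W Z F := by
  rw [sub_eq_add_neg]
  exact (energyNormW_add_le L k W Y (-Z) F).trans (by rw [energyNormW_neg])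

/-! ## §2 The crude curl bound and relative pointwise bounds -/

/-- **THE CRUDE CURL BOUND ON THE TORUS**: for unitary `V`, an `M`-periodic direction (`M ≥ 1`):
`curlSq V Z (periodBox M) ≤ 16d·dirSq Z (periodBox M)`. [folklore] -/
theorem curlSq_le_dirSq {V : Site d → Fin d → (Matrix n n ℂ)ˣ} (hV : IsUnitaryCfg V) {M : ℕ} (hM : 1 ≤ M)
    {Z : Site d → Fin d → Matrix n n ℂ} (hZ : IsPeriodicDir Z M) :
    curlSq V Z (periodBox M) ≤ 16 * d * dirSq Z (periodBox M) := by
  rw [curlSq_eq_sum_plaqsOf]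
  have h1 : ∑ p ∈ plaqsOf (periodBox M), ‖curl V Z p‖ ^ 2 ≤ ∑ p ∈ plaqsOf (periodBox M), 4 * bondSq Z p :=
    Finset.sum_le_sum fun p _ => norm_curlAt_sq_le hV Z p.1 p.2.1.1 p.2.1.2
  rw [← Finset.mul_sum] at h1
  have h2 := sum_plaqsOf_bondSq_le hM hZ
  nlinarith

/-- **A POINTWISE RELATIVE BOUND COSTS ONE `L^k`**: if `‖Z x μ‖ ≤ c·‖Y x μ‖` everywhere (`c ≥ 0`), `Z` `M`-periodic, `V` unitary,
`M, L ≥ 1`, then `N_w(Z) ≤ √(16d+1)·c·L^k·N_w(Y)` on `periodBox M`. [folklore] -/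
theorem energyNormW_le_of_pointwise {V : Site d → Fin d → (Matrix n n ℂ)ˣ} (hV : IsUnitaryCfg V) {L : ℕ} (hL : 1 ≤ L) (k : ℕ)
    {M : ℕ} (hM : 1 ≤ M) {Y Z : Site d → Fin d → Matrix n n ℂ} (hZ : IsPeriodicDir Z M) {c : ℝ} (hc : 0 ≤ c)
    (hpt : ∀ x μ, ‖Z x μ‖ ≤ c * ‖Y x μ‖) :
    energyNormW L k V Z (periodBox M) ≤ Real.sqrt (16 * d + 1) * c * (L : ℝ) ^ k * energyNormW L k V Y (periodBox M) := by
  have hL1 : (1 : ℝ) ≤ (L : ℝ) ^ k := one_le_pow₀ (by exact_mod_cast hL)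
  have hNY := energyNormW_nonneg L k V Y (periodBox M)
  have hdZ : dirSq Z (periodBox M) ≤ c ^ 2 * dirSq Y (periodBox M) := by
    unfold dirSq; rw [Finset.mul_sum]
    refine Finset.sum_le_sum fun x _ => ?_
    rw [Finset.mul_sum]
    refine Finset.sum_le_sum fun μ _ => ?_
    have h := hpt x μ
    have h0 := norm_nonneg (Z x μ)
    nlinarith [norm_nonneg (Y x μ)]
  have hdY := dirSq_le_pow_sq_mul_energyNormW_sq hL k V Y (periodBox M)
  have hZsq : energyNormW L k V Z (periodBox M) ^ 2 = curlSq V Z (periodBox M) + ((L : ℝ) ^ k)⁻¹ ^ 2 * dirSq Z (periodBox M) := by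
    unfold NE3EnergyWeightedShapes.energyNormW
    rw [Real.sq_sqrt (energySq_nonneg L k V Z (periodBox M))]
  have hsq : energyNormW L k V Z (periodBox M) ^ 2 ≤ (16 * d + 1) * (c ^ 2 * (((L : ℝ) ^ k) ^ 2 * energyNormW L k V Y (periodBox M) ^ 2)) := by
    rw [hZsq]
    have hcurl := curlSq_le_dirSq hV hM hZ
    have hw : ((L : ℝ) ^ k)⁻¹ ^ 2 ≤ 1 := by
      rw [inv_pow]; exact inv_le_one_of_one_le₀ (one_le_pow₀ hL1)
    have hdZ0 := dirSq_nonneg Z (periodBox M)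
    have : ((L : ℝ) ^ k)⁻¹ ^ 2 * dirSq Z (periodBox M) ≤ dirSq Z (periodBox M) := by nlinarith
    have hd16 : (0:ℝ) ≤ 16 * d := by positivity
    have h1 : dirSq Z (periodBox M) ≤ c ^ 2 * (((L : ℝ) ^ k) ^ 2 * energyNormW L k V Y (periodBox M) ^ 2) :=
      hdZ.trans (mul_le_mul_of_nonneg_left hdY (sq_nonneg c))
    have h2 := mul_le_mul_of_nonneg_left h1 hd16
    linarith [hcurl, this, h1, h2]
  have hR : 0 ≤ Real.sqrt (16 * d + 1) * c * (L : ℝ) ^ k * energyNormW L k V Y (periodBox M) := by positivity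
  have hRHS : (16 * d + 1) * (c ^ 2 * (((L : ℝ) ^ k) ^ 2 * energyNormW L k V Y (periodBox M) ^ 2))
      = (Real.sqrt (16 * d + 1) * c * (L : ℝ) ^ k * energyNormW L k V Y (periodBox M)) ^ 2 := by
    rw [mul_pow, mul_pow, mul_pow, Real.sq_sqrt (by positivity)]; ring
  rw [hRHS] at hsq
  have h := Real.sqrt_le_sqrt hsq
  rwa [Real.sqrt_sq (energyNormW_nonneg _ _ _ _ _), Real.sqrt_sq hR] at h

/-! ## §3 The ℓ¹ bond multiplicity on the torus -/

/-- **ℓ¹ BOND MULTIPLICITY ON THE TORUS**: for a direction whose bond norms are `M`-periodic (`M ≥ 1`),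
`Σ_{p ∈ plaqsOf (periodBox M)} bondL1 Z p ≤ 4d · dirL1 Z (periodBox M)` — the ℓ¹ twin of `NE3HessShapes.sum_plaqsOf_bondSq_le`
(same over-count of planes by ordered pairs; periodic shifts by `sum_periodBox_shift`). [folklore] -/
theorem sum_plaqsOf_bondL1_le {M : ℕ} (hM : 1 ≤ M) {Z : Site d → Fin d → Matrix n n ℂ} (hZ : IsPeriodicDir Z M) :
    ∑ p ∈ plaqsOf (periodBox M), bondL1 Z p ≤ 4 * d * dirL1 Z (periodBox M) := by
  rw [sum_plaqsOf]
  have hshift : ∀ (μ ν : Fin d), ∑ z ∈ periodBox M, ‖Z (z + e μ) ν‖ = ∑ z ∈ periodBox M, ‖Z z ν‖ :=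
    fun μ ν => sum_periodBox_shift M hM (g := fun x => ‖Z x ν‖) (fun x κ => by simp only [hZ x κ ν]) (e μ)
  set S : Fin d → ℝ := fun κ => ∑ z ∈ periodBox M, ‖Z z κ‖ with hS
  have hS0 : ∀ κ, 0 ≤ S κ := fun κ => by rw [hS]; positivity
  have hdir : dirL1 Z (periodBox M) = ∑ κ : Fin d, S κ := by
    unfold dirL1; rw [Finset.sum_comm]
  have hplane : ∑ z ∈ periodBox M, ∑ π : T4AveragingDeficitWall.Plane d, bondL1 Z (z, π)
      = ∑ π : T4AveragingDeficitWall.Plane d, (2 * S π.1.1 + 2 * S π.1.2) := by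
    rw [Finset.sum_comm]
    refine Finset.sum_congr rfl fun π _ => ?_
    simp only [bondL1, bondL1At, Finset.sum_add_distrib, hshift, hS]
    ring
  rw [hplane]
  have hsub : ∑ π : T4AveragingDeficitWall.Plane d, (2 * S π.1.1 + 2 * S π.1.2)
      ≤ ∑ q : Fin d × Fin d, (2 * S q.1 + 2 * S q.2) := by
    have hset : ∀ q : Fin d × Fin d,
        q ∈ (Finset.univ : Finset (Fin d × Fin d)).filter (fun q => q.1 < q.2) ↔ q.1 < q.2 := fun q => by simp
    rw [← Finset.sum_subtype ((Finset.univ : Finset (Fin d × Fin d)).filter (fun q => q.1 < q.2)) hset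
      (fun q : Fin d × Fin d => 2 * S q.1 + 2 * S q.2)]
    exact Finset.sum_le_sum_of_subset_of_nonneg (Finset.filter_subset _ _)
      (fun q _ _ => by have := hS0 q.1; have := hS0 q.2; positivity)
  have hpair : ∑ q : Fin d × Fin d, (2 * S q.1 + 2 * S q.2) = 4 * d * ∑ κ : Fin d, S κ := by
    rw [Fintype.sum_prod_type]
    simp only [Finset.sum_add_distrib, Finset.sum_const, Finset.card_univ, Fintype.card_fin, nsmul_eq_mul,
      ← Finset.mul_sum]
    ring
  rw [hdir]
  linarith

/-- The crude ℓ¹-curl bound on the torus: `Σ_{p∈perWin} ‖curl V Z p‖ ≤ 4d·dirL1 Z (periodBox M)` for unitary `V`. [folklore] -/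
theorem sum_norm_curl_le_dirL1 {V : Site d → Fin d → (Matrix n n ℂ)ˣ} (hV : IsUnitaryCfg V) {M : ℕ} (hM : 1 ≤ M)
    {Z : Site d → Fin d → Matrix n n ℂ} (hZ : IsPeriodicDir Z M) :
    ∑ p ∈ plaqsOf (periodBox M), ‖curl V Z p‖ ≤ 4 * d * dirL1 Z (periodBox M) := by
  refine le_trans (Finset.sum_le_sum fun p _ => ?_) (sum_plaqsOf_bondL1_le hM hZ)
  exact norm_curlAt_le hV Z p.1 p.2.1.1 p.2.1.2

/-- A two-field pointwise relative bound in the weighted norm: `‖Z b‖ ≤ c(‖Y b‖ + ‖Y′ b‖)` pointwise ⟹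
`N_w Z ≤ √2·√(16d+1)·c·L^k·(N_w Y + N_w Y′)`. [folklore] -/
theorem energyNormW_le_of_pointwise₂ {V : Site d → Fin d → (Matrix n n ℂ)ˣ} (hV : IsUnitaryCfg V) {L : ℕ} (hL : 1 ≤ L) (k : ℕ)
    {M : ℕ} (hM : 1 ≤ M) {Y Y' Z : Site d → Fin d → Matrix n n ℂ} (hZ : IsPeriodicDir Z M) {c : ℝ} (hc : 0 ≤ c)
    (hpt : ∀ x μ, ‖Z x μ‖ ≤ c * (‖Y x μ‖ + ‖Y' x μ‖)) :
    energyNormW L k V Z (periodBox M)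
      ≤ Real.sqrt 2 * Real.sqrt (16 * d + 1) * c * (L : ℝ) ^ k * (energyNormW L k V Y (periodBox M) + energyNormW L k V Y' (periodBox M)) := by
  -- the auxiliary field `A b := (‖Y b‖ + ‖Y′ b‖)·1` has `‖A b‖ = ‖Y b‖ + ‖Y′ b‖` ... we avoid it: work with `dirSq` directly
  have hL1 : (1 : ℝ) ≤ (L : ℝ) ^ k := one_le_pow₀ (by exact_mod_cast hL)
  have hNY := energyNormW_nonneg L k V Y (periodBox M); have hNY' := energyNormW_nonneg L k V Y' (periodBox M)
  have hdZ : dirSq Z (periodBox M) ≤ 2 * c ^ 2 * (dirSq Y (periodBox M) + dirSq Y' (periodBox M)) := by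
    unfold dirSq
    rw [← Finset.sum_add_distrib, Finset.mul_sum]
    refine Finset.sum_le_sum fun x _ => ?_
    rw [← Finset.sum_add_distrib, Finset.mul_sum]
    refine Finset.sum_le_sum fun μ _ => ?_
    have h := hpt x μ
    have h0 := norm_nonneg (Z x μ)
    nlinarith [norm_nonneg (Y x μ), norm_nonneg (Y' x μ), sq_nonneg (‖Y x μ‖ - ‖Y' x μ‖)]
  have hdY := dirSq_le_pow_sq_mul_energyNormW_sq hL k V Y (periodBox M)
  have hdY' := dirSq_le_pow_sq_mul_energyNormW_sq hL k V Y' (periodBox M)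
  have hZsq : energyNormW L k V Z (periodBox M) ^ 2 = curlSq V Z (periodBox M) + ((L : ℝ) ^ k)⁻¹ ^ 2 * dirSq Z (periodBox M) := by
    unfold NE3EnergyWeightedShapes.energyNormW
    rw [Real.sq_sqrt (energySq_nonneg L k V Z (periodBox M))]
  have hsq : energyNormW L k V Z (periodBox M) ^ 2
      ≤ (16 * d + 1) * (2 * c ^ 2 * (((L : ℝ) ^ k) ^ 2 * (energyNormW L k V Y (periodBox M) + energyNormW L k V Y' (periodBox M)) ^ 2)) := by
    rw [hZsq]
    have hcurl := curlSq_le_dirSq hV hM hZ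
    have hw : ((L : ℝ) ^ k)⁻¹ ^ 2 ≤ 1 := by rw [inv_pow]; exact inv_le_one_of_one_le₀ (one_le_pow₀ hL1)
    have hdZ0 := dirSq_nonneg Z (periodBox M)
    have hw' : ((L : ℝ) ^ k)⁻¹ ^ 2 * dirSq Z (periodBox M) ≤ dirSq Z (periodBox M) := by nlinarith
    have hd16 : (0:ℝ) ≤ 16 * d := by positivity
    have h1 : dirSq Z (periodBox M) ≤ 2 * c ^ 2 * (((L : ℝ) ^ k) ^ 2 * (energyNormW L k V Y (periodBox M) + energyNormW L k V Y' (periodBox M)) ^ 2) := by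
      refine hdZ.trans (mul_le_mul_of_nonneg_left ?_ (by positivity))
      have hab : energyNormW L k V Y (periodBox M) ^ 2 + energyNormW L k V Y' (periodBox M) ^ 2
          ≤ (energyNormW L k V Y (periodBox M) + energyNormW L k V Y' (periodBox M)) ^ 2 := by
        nlinarith [mul_nonneg hNY hNY']
      have h3 := mul_le_mul_of_nonneg_left hab (sq_nonneg ((L : ℝ) ^ k))
      linarith [hdY, hdY', h3]
    have h2 := mul_le_mul_of_nonneg_left h1 hd16
    linarith [hcurl, hw', h1, h2]
  have hR : 0 ≤ Real.sqrt 2 * Real.sqrt (16 * d + 1) * c * (L : ℝ) ^ k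
      * (energyNormW L k V Y (periodBox M) + energyNormW L k V Y' (periodBox M)) :=
    mul_nonneg (mul_nonneg (mul_nonneg (mul_nonneg (Real.sqrt_nonneg _) (Real.sqrt_nonneg _)) hc)
      (pow_nonneg (Nat.cast_nonneg L) k)) (add_nonneg hNY hNY')
  have hRHS : (16 * d + 1) * (2 * c ^ 2 * (((L : ℝ) ^ k) ^ 2 * (energyNormW L k V Y (periodBox M) + energyNormW L k V Y' (periodBox M)) ^ 2))
      = (Real.sqrt 2 * Real.sqrt (16 * d + 1) * c * (L : ℝ) ^ k
          * (energyNormW L k V Y (periodBox M) + energyNormW L k V Y' (periodBox M))) ^ 2 := by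
    rw [mul_pow, mul_pow, mul_pow, mul_pow, Real.sq_sqrt (by positivity), Real.sq_sqrt (by positivity)]; ring
  rw [hRHS] at hsq
  have h := Real.sqrt_le_sqrt hsq
  rwa [Real.sqrt_sq (energyNormW_nonneg _ _ _ _ _), Real.sqrt_sq hR] at h


end

end Summit.QuantumFields.BalabanUV.T4Continuum.NE3ProductPathBounds
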